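import Summits.BirchSwinnertonDyer.BirchSwinnertonDyer.Theorems.KatoDescentPotSupersingularWildUpperReducibleNineTorsionKodaira
import Literature.NumberTheory.EllipticCurves.KubertTateNineBadPrimes
import HarnessLib

/-!
# Route `KatoDescentPotSupersingular` (rung K9, cell `bsd-potss`), crux `WildUpperReducibleDefect` (item
# stmt-BirchSwinnertonDyer-19190), registered stub `stub_red_nineTorsionMember`: the `ℤ/9` disjunct is NON-CM and every
# one of its classes has a MULTIPLICATIVE PRIME `q ≠ 3` — UNCONDITIONALLY. ROUTE-FREE (imports no `Theses.*` file); a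
# `--supports 19190 --as helper` file (seat `bsd-potss-k9-red9` g7); nothing booked, BSD is not proved by any of this.

The rows of `stub_red_nineTorsionMember` are: `W/ℚ` globally minimal, `r_an = 0`, class O6 at `3` (so additive at `3`),
`W[3]` reducible, and SOME `W' ∼ W` with `3² ∣ #W'(ℚ)_tors`. Seat generations g5/g6 typed the disjunct structurally (a
rational point of ORDER `9` on `W'`, Kubert's chart `C • W' = E₉(f)`, semistable away from `3`, type `IV` / `f₃ = 3` /
`c₃ = 3` at `3`). This file executes door 6 of the seat's repair census (g5 memo §3 / g6 memo §4: «CM exclusion») and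
adds the away-from-`3` half of the local portrait, from the Literature theorems `KubertTateNineJInvariant` /
`KubertTateNineBadPrimes` (this seat, g7): for `C • W' = E₉(f)` and every prime `q ∣ num(f)·den(f)·(num(f) - den(f))`
one has `v_q(j(W')) = -9·v_q(num·den·(num - den)) ≤ -9`; such a prime exists; on the additive fibre `3 ∣ num + den`
it is `≠ 3`, and `v₃(j(W')) = 1`.

CONTENT (all unconditional; no named fact is used):
* §1 one curve: a globally minimal `W/ℚ`, additive at `3`, with a rational point of order `9` has **no complex
  multiplication**, **`v₃(j(W)) = 1`**, and **a prime `q ≠ 3` of MULTIPLICATIVE reduction with `v_q(j(W)) ≤ -9`**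
  (`‖j‖_q > 1` excludes good reduction — `norm_j_le_one_of_hasGoodReductionAtPrime`; the torsion injection excludes
  additive reduction at `q ≠ 3` — g5's `not_addv_of_addOrderOf_eq_nine`; trichotomy).
* §2 the rows: `Addv W 3`, `W ∼ W'`, `3² ∣ #W'(ℚ)_tors` ⟹ **`¬ W'.HasCM`, `¬ W.HasCM`** (multiplicative reduction
  transports along the isogeny, `X2.mult_iff_of_isIsogenous`, and forces `‖j(W)‖_q > 1`,
  `one_lt_norm_j_of_hasMultiplicativeReductionAtPrime`; CM `j`-invariants are integral, `not_hasCM_of_one_lt_norm_j`)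
  and **`∃ q ≠ 3` prime with `Mult W q ∧ Mult W' q`**; the `ClassO6 W 3` forms and the reading on the stub's displayed
  hypothesis `∃ W' …`.

WHAT THIS SAYS ABOUT THE RESIDUE (numbers, not adjectives): every row of the `ℤ/9` disjunct lies in the cell's
EXCLUDED-DOMAIN «non-CM» by THEOREM (not by census), and its conductor is `27·M` with `M` squarefree, prime to `3`
(g5/g6) and **`M > 1`** (this file: a multiplicative prime `q ≠ 3` exists) — census C-X3K-0: `54 = 27·2`,
`1890 = 27·70`, `122094 = 27·4522` ✓. WHAT THIS IS NOT: not a bound on `Ш`; the stub is not advanced class-wide (it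
remains Kato's count-fact road, item settled-by-citation via glue 19711); nothing is booked; no item is closed.

References: [Kubert1976] Table 3 (`N = 9`); [BarriosRoy2022LocalData] §3.5 Case 3 («`E_{C₉}` additive at `p` iff
`p = 3`, `v₃(a+b) ≥ 1`»); [SilvermanAEC2009] Prop. VII.5.1, VII.5.5, Cor. VII.7.2, App. C §11; [SilvermanATAEC1994]
Thm. II.6.1.
-/

set_option autoImplicit false
-- the Theorems directory repeats the summit name (sibling precedent `KatoDescentPotSupersingularAssembly.lean`)
set_option linter.dupNamespace false

noncomputable section

open scoped Classical

namespace Summit.BirchSwinnertonDyer.BirchSwinnertonDyer.Theorems.WildUpperReducibleNineTorsionNonCM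

open WeierstrassCurve IsDedekindDomain Literature.NumberTheory.EllipticCurves
  Literature.NumberTheory.EllipticCurves.Rank1Residual
  Summit.BirchSwinnertonDyer.Rank1Residual
  Summit.BirchSwinnertonDyer.Rank1Residual.Additive
  Summit.BirchSwinnertonDyer.BirchSwinnertonDyer.Theorems.WildUpperReducibleNineTorsionLocal
  Summit.BirchSwinnertonDyer.BirchSwinnertonDyer.Theorems.WildUpperReducibleNineTorsionStructure
  Summit.BirchSwinnertonDyer.BirchSwinnertonDyer.Theorems.WildUpperReducibleNineTorsionKodaira

/-! ## §1 One curve with a rational point of order `9` -/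

section OneCurve

variable (W : WeierstrassCurve ℚ) [W.IsElliptic] [Fact (Nat.Prime 3)]

omit [Fact (Nat.Prime 3)] in
/-- **A curve over `ℚ` with a rational point of order `9` has no complex multiplication** (its `j`-invariant has
a pole of order `≥ 9` at some prime; CM `j`-invariants are integers) — the Literature theorem
`not_hasCM_of_addOrderOf_eq_nine`, recorded at the stub. [cite: SilvermanATAEC1994, Thm. II.6.1]
[cite: Kubert1976, Table 3 (N = 9)] -/
theorem not_hasCM_of_nine_dvd_torsionOrder (h9 : 3 ^ 2 ∣ W.torsionOrder) : ¬ W.HasCM := by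
  obtain ⟨P, hP⟩ := exists_addOrderOf_eq_nine_of_dvd_torsionOrder W h9
  exact not_hasCM_of_addOrderOf_eq_nine W hP

/-- **`v₃(j(W)) = 1` for a curve additive at `3` with a rational point of order `9`** (Kubert's chart lands on the
fibre `3 ∣ num + den`, where `(v₃c₄, v₃Δ) = (2, 5)`). [cite: BarriosRoy2022LocalData, Thm. 3.8 (table, T = C₉, p = 3) and §3.5 Case 3] -/
theorem padicValRat_three_j_eq_one_of_addv_of_addOrderOf_eq_nine (hadd : Addv W 3) {P : W.toAffine.Point}
    (hP : addOrderOf P = 9) : padicValRat 3 W.j = 1 := by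
  obtain ⟨f, -, -, -, C, hC⟩ := exists_kubertTate_nine_of_addOrderOf_eq_nine W hP
  exact padicValRat_three_j_of_smul_eq_kubertTate_nine_of_three_dvd_add hC (three_dvd_num_add_den_of_addv W hadd hC)

variable [W.IsGloballyMinimal]

/-- **A prime `q ≠ 3` of MULTIPLICATIVE reduction with `v_q(j) ≤ -9`** for a globally minimal curve additive at `3`
with a rational point of order `9`: in Kubert's chart `C • W = E₉(f)` with `3 ∣ num + den`, any prime
`q ∣ num·den·(num - den)` is `≠ 3` and has `‖j(W)‖_q > 1` (`KubertTateNineBadPrimes`), so `W` is not good at `q`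
(`norm_j_le_one_of_hasGoodReductionAtPrime`) and not additive at `q` (`not_addv_of_addOrderOf_eq_nine`: `9 ∣ c_q·… ≤ 4`
is absurd) — multiplicative by trichotomy. [cite: BarriosRoy2022LocalData, §3.5 Case 3]
[cite: SilvermanAEC2009, Prop. VII.5.1 and Prop. VII.5.5] -/
theorem exists_mult_prime_ne_three_of_addv_of_addOrderOf_eq_nine (hadd : Addv W 3) {P : W.toAffine.Point}
    (hP : addOrderOf P = 9) :
    ∃ (q : ℕ) (_ : Fact q.Prime), q ≠ 3 ∧ Mult W q ∧ padicValRat q W.j ≤ -9 ∧ 1 < ‖(W.j : ℚ_[q])‖ := by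
  obtain ⟨f, -, -, -, C, hC⟩ := exists_kubertTate_nine_of_addOrderOf_eq_nine W hP
  obtain ⟨q, hq, hq3, hv, hn, hng⟩ :=
    exists_prime_ne_three_one_lt_norm_j_of_smul_eq_kubertTate_nine_of_three_dvd_add hC
      (three_dvd_num_add_den_of_addv W hadd hC)
  refine ⟨q, hq, hq3, ?_, hv, hn⟩
  by_contra hm
  exact not_addv_of_addOrderOf_eq_nine W hq3 hP ⟨hng, hm⟩

/-- The same from `3² ∣ #W(ℚ)_tors` (a rational point of order `9` exists, Mazur-free,
`exists_addOrderOf_eq_nine_of_dvd_torsionOrder`). [cite: BarriosRoy2022LocalData, §3.5 Case 3]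
[cite: SilvermanAEC2009, Prop. VII.5.1] -/
theorem exists_mult_prime_ne_three_of_addv_of_nine_dvd_torsionOrder (hadd : Addv W 3)
    (h9 : 3 ^ 2 ∣ W.torsionOrder) :
    ∃ (q : ℕ) (_ : Fact q.Prime), q ≠ 3 ∧ Mult W q ∧ padicValRat q W.j ≤ -9 ∧ 1 < ‖(W.j : ℚ_[q])‖ := by
  obtain ⟨P, hP⟩ := exists_addOrderOf_eq_nine_of_dvd_torsionOrder W h9
  exact exists_mult_prime_ne_three_of_addv_of_addOrderOf_eq_nine W hadd hP

end OneCurve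

/-! ## §2 The rows of `stub_red_nineTorsionMember` -/

section Rows

variable {W W' : WeierstrassCurve ℚ} [W.IsElliptic] [W'.IsElliptic] [Fact (Nat.Prime 3)]

omit [W.IsElliptic] [Fact (Nat.Prime 3)] in
/-- **The `ℤ/9` member of a row has no CM** (`3² ∣ #W'(ℚ)_tors` alone suffices). [cite: SilvermanATAEC1994, Thm. II.6.1]
[cite: Kubert1976, Table 3 (N = 9)] -/
theorem nineTorsionMember_not_hasCM (h9 : 3 ^ 2 ∣ W'.torsionOrder) : ¬ W'.HasCM :=
  not_hasCM_of_nine_dvd_torsionOrder W' h9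

/-- **Every row has a prime `q ≠ 3` at which BOTH `W` and its `ℤ/9` member `W'` are multiplicative.** `W` additive at
`3` (any equation), `W ∼ W'`, `3² ∣ #W'(ℚ)_tors`: pass to a globally minimal model `C • W'` (same torsion, *AEC*
VIII.8.3), additive at `3` (`X2.addv_iff_of_isIsogenous`), apply §1, and transport multiplicative reduction back
along the isogeny (`X2.mult_iff_of_isIsogenous`, *AEC* VII.7.2). So `N_W = 27·M` with `M > 1` (squarefree and
prime to `3` by g5/g6). [cite: BarriosRoy2022LocalData, §3.5 Case 3] [cite: SilvermanAEC2009, Prop. VII.5.1 and Cor. VII.7.2] -/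
theorem exists_mult_prime_ne_three_of_nineTorsionMember (hadd : Addv W 3) (hiso : IsIsogenous W W')
    (h9 : 3 ^ 2 ∣ W'.torsionOrder) : ∃ (q : ℕ) (_ : Fact q.Prime), q ≠ 3 ∧ Mult W q ∧ Mult W' q := by
  obtain ⟨C, hC⟩ := hasGlobalMinimalModel_rat_holds W'
  haveI := hC
  have hiso' : IsIsogenous W (C • W') := hiso.smul_right C
  have h9' : 3 ^ 2 ∣ (C • W').torsionOrder := by rwa [torsionOrder_variableChange_holds W' C]
  have hadd' : Addv (C • W') 3 := (X2.addv_iff_of_isIsogenous hiso').mp hadd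
  obtain ⟨q, hq, hq3, hm, -, -⟩ := exists_mult_prime_ne_three_of_addv_of_nine_dvd_torsionOrder (C • W') hadd' h9'
  have hmW : Mult W q := (X2.mult_iff_of_isIsogenous hiso').mpr hm
  exact ⟨q, hq, hq3, hmW, (X2.mult_iff_of_isIsogenous hiso).mp hmW⟩

/-- **No row of the `ℤ/9` disjunct is CM**: `W` additive at `3`, `W ∼ W'`, `3² ∣ #W'(ℚ)_tors` ⟹ `¬ W.HasCM` (a prime
of multiplicative reduction gives `‖j(W)‖_q > 1`, `one_lt_norm_j_of_hasMultiplicativeReductionAtPrime`, and CM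
`j`-invariants are integers, `not_hasCM_of_one_lt_norm_j`). The cell's PARTITION domain «non-CM» holds on this stub
by theorem. [cite: SilvermanATAEC1994, Thm. II.6.1] [cite: SilvermanAEC2009, Prop. VII.5.1(b) and Prop. VII.5.5] -/
theorem not_hasCM_of_nineTorsionMember (hadd : Addv W 3) (hiso : IsIsogenous W W')
    (h9 : 3 ^ 2 ∣ W'.torsionOrder) : ¬ W.HasCM := by
  obtain ⟨q, hq, -, hm, -⟩ := exists_mult_prime_ne_three_of_nineTorsionMember hadd hiso h9
  exact not_hasCM_of_one_lt_norm_j W (one_lt_norm_j_of_hasMultiplicativeReductionAtPrime hm)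

/-- **The O6 form** (the stub's literal hypothesis `ClassO6 W 3`): a class-O6 row with a `ℤ/9` member is non-CM and
has a prime `q ≠ 3` of multiplicative reduction shared by `W` and the member. [cite: BarriosRoy2022LocalData, §3.5 Case 3]
[cite: SilvermanAEC2009, Prop. VII.5.5 and Cor. VII.7.2] -/
theorem nineTorsionMember_nonCM_of_classO6 [W.IsGloballyMinimal] (hO : ClassO6 W 3) (hiso : IsIsogenous W W')
    (h9 : 3 ^ 2 ∣ W'.torsionOrder) :
    ¬ W.HasCM ∧ ¬ W'.HasCM ∧ ∃ (q : ℕ) (_ : Fact q.Prime), q ≠ 3 ∧ Mult W q ∧ Mult W' q :=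
  ⟨not_hasCM_of_nineTorsionMember hO.2.1 hiso h9, nineTorsionMember_not_hasCM h9,
    exists_mult_prime_ne_three_of_nineTorsionMember hO.2.1 hiso h9⟩

/-- **Reading on the stub's displayed hypothesis.** On a row of `stub_red_nineTorsionMember` — `W` additive at `3` and
`∃ W' ∼ W` with `3² ∣ #W'(ℚ)_tors` — `W` has no CM and some prime `q ≠ 3` of multiplicative reduction: the `ℤ/9`
disjunct of crux 19190 has NO CM rows and NO rows of prime-power conductor. [cite: BarriosRoy2022LocalData, §3.5 Case 3]
[cite: SilvermanATAEC1994, Thm. II.6.1] -/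
theorem not_hasCM_and_exists_mult_of_nineTorsionMember (hadd : Addv W 3)
    (h : ∃ (W' : WeierstrassCurve ℚ) (_ : W'.IsElliptic), IsIsogenous W W' ∧ 3 ^ 2 ∣ W'.torsionOrder) :
    ¬ W.HasCM ∧ ∃ (q : ℕ) (_ : Fact q.Prime), q ≠ 3 ∧ Mult W q := by
  obtain ⟨W', hE', hiso, h9⟩ := h
  obtain ⟨q, hq, hq3, hm, -⟩ := exists_mult_prime_ne_three_of_nineTorsionMember hadd hiso h9
  exact ⟨not_hasCM_of_nineTorsionMember hadd hiso h9, q, hq, hq3, hm⟩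

end Rows

end Summit.BirchSwinnertonDyer.BirchSwinnertonDyer.Theorems.WildUpperReducibleNineTorsionNonCM

end
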